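/-
Copyright (c) 2026 the pub-hodgecm-mathlib formalisation cell (harness21).  Prover seat hodgecm-mathlib-LH4-p01 (g10): road M6 → F3 «TOT-Λ BY OVER-ORDERS» (LEAD F0P3a-plan
T14-66), carve (c5-ii) «MODEL PACKAGE SELECTION» (F3-5 pen LH7-p04 (g12) 00:24:06Z «= TAKE», 00:48:47Z «= FILE B»), FILE B «THE ENDOSCOPIC FRAME OF A BLOCK FRAME»; 2026-09-03.
-/
import Literature.NumberTheory.Rogawski1990.EndoscopicBlockFrameBridgeInputs   -- ★ (c5-i) p853057 (LH10-p01 (g10)): (P0) `aeval_blockFrame_cubic_eq_zero`, (K) `isUnit_det_krylov_blockFrame`, `det_krylov_blockFrame`; brings ★ (O-5) `endoPerm`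
import Literature.NumberTheory.Automorphic.TypeTwoCommutantBridge              -- ★ (D3) p846… (A-p19): `exists_algHom_prod`, `exists_aeval_prod_eq`, `hstar_of_algHom_prod`
import HarnessLib

/-!
# The endoscopic frame of a block frame: `φ′ : E × K →ₐ[E] M₃(E)`, injective, `φ′(u, λ) = φ(g, u)`, a cyclic vector, surjectivity of `P ↦ P(u, λ)`, and the adjoint relation
# (Lang XIV §3, II §2; Rogawski 1990 §4.9; Jacobowitz §7)

Topic `NumberTheory/Rogawski1990`; namespace `Literature.NumberTheory.Rogawski1990`.  THEOREMS ONLY (no definition, no instance, no notation, no named fact, no `sorry`); kernel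
lane `--supports stmt-HodgeConjecture-24833`.  Cell `pub/hodgecm-mathlib` (D-0151), crux H413 = `stmt-HodgeConjecture-24833`; road M6 → F3 «TOT-Λ by over-orders» (route (B));
carve **(c5-ii) «MODEL PACKAGE SELECTION», FILE B**: the FIELD-LEVEL endoscopic letters `φ hφ τB hτB hK hstar hK2` of ★ F3-2a ∕ ★ F3-2b ∕ F3-5a ∕ F3-5b (frame «`φ : (E × K) →ₐ[E]
M₃(E)` injective, `φ τB = τ`, Krylov unit at `w₀`, `J·φ(b⋆) = (σφb)ᵀ·J`») for the BLOCK FRAME `φ (g, u) = c·[g ⊕ u]·c⁻¹` of ★ (O-5) `EndoscopicBlockFrameAlgHom` ∕ ★ (W1)'s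
`hT`, assembled from ★ (c5-i) (the matrix half: cubic relation (P0), cyclic vector (K)) and ★ (D3) `TypeTwoCommutantBridge` (the bridge `exists_algHom_prod`, the surjectivity
`exists_aeval_prod_eq`, the adjoint relation `hstar_of_algHom_prod`).  MODEL-FREE: `E`, `K` any fields with `[Algebra E K]`, `λ ∈ K` a root of `χ_g = X² − (tr g)X + det g`
(rootless in `E`) with `K = E ⊕ Eλ`; at the inert CM place (FILE A `InertPlaceIntegralEisensteinFrame`) `K = M_{w₁}`, `λ = ι₁(u − a) + ι₁(−b)·Θ̃` (SIG (c5-ii) §2).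
HONEST LABEL: HC_CM is proved only modulo the 7 printed citations (2 remaining named inputs: hLiu418 = stmt-HodgeConjecture-24832, h413 = stmt-HodgeConjecture-24833) until rung 0
closes; linear algebra, count-neutral (pays no organ, opens no road; zero label movement until F5 ★ + a desk-priced rider).

THE MATHEMATICS.  `τ := φ(g, u)` is killed by `f = (X − u)·χ_g` (Cayley–Hamilton on the block matrix, ★ (c5-i) (P0)); `w₀ := c·(e₁ + e₂)` is cyclic as soon as `g₁₀ ≠ 0` and
`χ_g(u) ≠ 0` (★ (c5-i) (K), `det = −det c · g₁₀ · χ_g(u)`); `χ_g` rootless in `E` with the root `λ ∈ K = E ⊕ Eλ` ⇒ ★ (D3) gives `φ′ : E × K →ₐ[E] M₃(E)`, injective,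
`φ′(u, λ) = τ`, and every `b ∈ E × K` is `P(u, λ)`; `K = E ⊕ Eλ` with `λ ∉ E` ⇒ `dim_E K = 2`.  If moreover `τ` is `J`-unitary (`(στ)ᵀJτ = J`) and `x₀ := (u, λ)` satisfies
`x₀·x₀⋆ = 1` for `⋆ = (σ, σ_K)` (`σ_K` over `σ`), then `J·φ′(b⋆) = (σ φ′ b)ᵀ·J` for all `b` (★ (D3)).  No `2`, no valuation.
[cite: Lang2002, Ch. XIV §3; Ch. II §2] [cite: Rogawski1990, §4.9 Lemma 4.9.3 p. 56, §4.8 p. 53] [cite: Jacobowitz1962, §7] [cite: HornJohnson2013, §1.3]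

* §1 `det_blockFrame` (`det φ(g,u) = det g · u`), `finrank_eq_two_of_root` (`dim_E K = 2`);
* §2 **`exists_endoscopicFrame_of_blockFrame`** (`φ′`, injective, `φ′(u,λ) = φ(g,u)`, Krylov unit at `w₀ = c(e₁+e₂)`, surjectivity of `aeval (u, λ)`);
* §3 **`exists_endoscopicFrame_of_blockFrame_unitary`** (the same + `hstar` for a `J`-unitary `τ` and a norm-one `x₀`).

## References
* [Lang2002] S. Lang, *Algebra*, GTM 211 (2002): Ch. XIV §2–§3 (cyclic endomorphisms, `E[X]⁄(f)`), Ch. II §2 (CRT).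
* [Rogawski1990] J. D. Rogawski, *Automorphic Representations of Unitary Groups in Three Variables*, Ann. of Math. Stud. 123 (1990): §4.8 Case (a) p. 53, §4.9 Lemma 4.9.3 p. 56.
* [Jacobowitz1962] R. Jacobowitz, *Hermitian forms over local fields*, Amer. J. Math. 84 (1962): §7.
* [HornJohnson2013] R. A. Horn, C. R. Johnson, *Matrix Analysis*, 2nd ed. (2013): §1.3 (similarity and block matrices).
-/

set_option autoImplicit false

noncomputable section

open Polynomial Matrix

namespace Literature.NumberTheory.Rogawski1990

variable {E : Type*} [Field E] {K : Type*} [Field K] [Algebra E K]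
  (c : GL (Fin 3) E) (φ : (Matrix (Fin 2) (Fin 2) E × E) →ₐ[E] Matrix (Fin 3) (Fin 3) E)
  (hφ : ∀ (g : Matrix (Fin 2) (Fin 2) E) (u : E),
    φ (g, u) = (c : Matrix (Fin 3) (Fin 3) E) * Matrix.reindex endoPerm endoPerm (Matrix.fromBlocks g 0 0 (u • (1 : Matrix (Fin 1) (Fin 1) E))) *
      ((c⁻¹ : GL (Fin 3) E) : Matrix (Fin 3) (Fin 3) E))

/-! ## §1 Two frame facts: the determinant of the block frame and `dim_E K = 2` -/

include hφ in
/-- `det φ(g, u) = det g · u` (conjugation and re-indexing preserve the determinant; block-triangular determinant). [cite: HornJohnson2013, §1.3] -/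
theorem det_blockFrame (g : Matrix (Fin 2) (Fin 2) E) (u : E) : (φ (g, u)).det = g.det * u := by
  rw [hφ, Matrix.det_units_conj, Matrix.det_reindex_self, Matrix.det_fromBlocks_zero₁₂, Matrix.det_smul, Matrix.det_one,
    mul_one, Fintype.card_fin, pow_one]

omit [Algebra E K] in
/-- **`dim_E K = 2`** for `K = E ⊕ Eλ` with `λ` a root of a quadratic `X² − tX + D` rootless in `E` (`1, λ` is a basis). [cite: Lang2002, Ch. V §1] -/
theorem finrank_eq_two_of_root [Algebra E K] {t D : E} {lam : K} (hirr : ∀ x : E, x * x - t * x + D ≠ 0)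
    (hlam : lam ^ 2 - algebraMap E K t * lam + algebraMap E K D = 0)
    (hcoordlam : ∀ z : K, ∃ p q : E, z = algebraMap E K p + algebraMap E K q * lam) : Module.finrank E K = 2 := by
  -- linear independence of `(1, λ)`
  have hli : LinearIndependent E ![(1 : K), lam] := by
    refine LinearIndependent.pair_iff.2 fun s r hsr => ?_
    have hsr' : algebraMap E K s + algebraMap E K r * lam = 0 := by
      simpa [Algebra.smul_def] using hsr
    by_cases hr : r = 0
    · subst hr
      have hs : algebraMap E K s = 0 := by simpa using hsr'
      exact ⟨(algebraMap E K).injective (by rw [hs, map_zero]), rfl⟩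
    · exfalso
      -- `λ = −s ∕ r ∈ E` would be a root of `χ`
      have hlamE : lam = algebraMap E K (-s / r) := by
        have hr' : algebraMap E K r ≠ 0 := (_root_.map_ne_zero _).2 hr
        rw [map_div₀, map_neg, eq_div_iff hr']
        linear_combination hsr'
      apply hirr (-s / r)
      apply (algebraMap E K).injective
      rw [map_add, map_sub, map_mul, map_mul, ← hlamE, map_zero, ← hlam]
      ring
  -- spanning
  have hsp : ⊤ ≤ Submodule.span E (Set.range ![(1 : K), lam]) := by
    intro z _
    obtain ⟨p, q, hz⟩ := hcoordlam z
    rw [hz, Matrix.range_cons, Matrix.range_cons, Matrix.range_empty, Set.union_empty]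
    refine Submodule.add_mem _ ?_ ?_
    · rw [Algebra.algebraMap_eq_smul_one]
      exact Submodule.smul_mem _ _ (Submodule.subset_span (by simp))
    · rw [← Algebra.smul_def]
      exact Submodule.smul_mem _ _ (Submodule.subset_span (by simp))
  have b : Module.Basis (Fin 2) E K := Module.Basis.mk hli hsp
  rw [Module.finrank_eq_card_basis b, Fintype.card_fin]

/-! ## §2 The endoscopic frame of a block frame -/

include hφ in
/-- **(c5-ii-B) THE ENDOSCOPIC FRAME OF A BLOCK FRAME.**  For the block frame `φ (g, u) = c·[g ⊕ u]·c⁻¹` with `g₁₀ ≠ 0`, `χ_g = X² − (tr g)X + det g` rootless in `E`, and a root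
`λ ∈ K` with `K = E ⊕ Eλ`: there is `φ′ : E × K →ₐ[E] M₃(E)`, INJECTIVE, with `φ′ (u, λ) = φ (g, u)` (★ (D3) `exists_algHom_prod` on ★ (c5-i) (P0) + (K)); moreover the Krylov
matrix of `φ (g, u)` at `w₀ := c·(e₁ + e₂)` is invertible (★ (c5-i) (K)) and every `b ∈ E × K` is `P(u, λ)` (★ (D3) `exists_aeval_prod_eq`) — the letters `φ hφ τB hτB hK` of
★ F3-2a ∕ F3-2b ∕ F3-5 at `τ := φ (g, u)`, `τB := (u, λ)`. [cite: Lang2002, Ch. XIV §3; Ch. II §2] [cite: Rogawski1990, §4.9 Lemma 4.9.3 p. 56] [cite: HornJohnson2013, §1.3] -/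
theorem exists_endoscopicFrame_of_blockFrame (g : Matrix (Fin 2) (Fin 2) E) (u : E) (h10 : g 1 0 ≠ 0)
    (hirr : ∀ x : E, x * x - g.trace * x + g.det ≠ 0) (lam : K)
    (hlam : lam ^ 2 - algebraMap E K g.trace * lam + algebraMap E K g.det = 0)
    (hcoordlam : ∀ z : K, ∃ p q : E, z = algebraMap E K p + algebraMap E K q * lam) :
    ∃ φ' : (E × K) →ₐ[E] Matrix (Fin 3) (Fin 3) E, Function.Injective φ' ∧ φ' ((u, lam) : E × K) = φ (g, u) ∧
      IsUnit (Matrix.of fun i j : Fin 3 => (((φ (g, u)) ^ (j : ℕ)) *ᵥ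
        ((c : Matrix (Fin 3) (Fin 3) E) *ᵥ (Pi.single (endoPerm (Sum.inl 0)) (1 : E) + Pi.single (endoPerm (Sum.inr 0)) (1 : E)))) i).det ∧
      (∀ b : E × K, ∃ P : E[X], aeval ((u, lam) : E × K) P = b) := by
  have hχu : u * u - g.trace * u + g.det ≠ 0 := hirr u
  have hK : IsUnit (Matrix.of fun i j : Fin 3 => (((φ (g, u)) ^ (j : ℕ)) *ᵥ
      ((c : Matrix (Fin 3) (Fin 3) E) *ᵥ (Pi.single (endoPerm (Sum.inl 0)) (1 : E) + Pi.single (endoPerm (Sum.inr 0)) (1 : E)))) i).det :=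
    isUnit_det_krylov_blockFrame c φ hφ g u h10 hχu
  have hfτ := aeval_blockFrame_cubic_eq_zero c φ hφ g u
  obtain ⟨φ', hφ'inj, hφ'x⟩ :=
    Literature.NumberTheory.Automorphic.exists_algHom_prod u g.trace g.det lam (φ (g, u)) hfτ hK hlam hirr hχu hcoordlam
  exact ⟨φ', hφ'inj, hφ'x, hK, fun b => Literature.NumberTheory.Automorphic.exists_aeval_prod_eq u g.trace g.det lam hχu hcoordlam hlam b⟩

/-! ## §3 The unitary case: the adjoint relation `hstar` -/

include hφ in
/-- **(c5-ii-B′) THE ENDOSCOPIC FRAME OF A UNITARY BLOCK.**  As `exists_endoscopicFrame_of_blockFrame`, and moreover: if `⋆ = (σ, σ_K)` with `σ_K ∘ ι = ι ∘ σ`, `τ := φ (g, u)` is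
`J`-unitary (`(στ)ᵀJτ = J`), `det g ≠ 0 ∧ u ≠ 0` (so `τ` is invertible) and `(u, λ)·(σu, σ_Kλ) = 1`, then `J·φ′(b⋆) = (σ φ′ b)ᵀ·J` for every `b ∈ E × K` — the letter `hstar`
of ★ F3-2a ∕ F3-2b ∕ F3-5 (★ (D3) `hstar_of_algHom_prod`). [cite: Rogawski1990, §4.9 p. 55] [cite: Jacobowitz1962, §7] [cite: Lang2002, Ch. XIV §3] -/
theorem exists_endoscopicFrame_of_blockFrame_unitary (σ : E →+* E) (σK : K →+* K) (hσK : ∀ x, σK (algebraMap E K x) = algebraMap E K (σ x))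
    (g : Matrix (Fin 2) (Fin 2) E) (u : E) (h10 : g 1 0 ≠ 0) (hu : u ≠ 0)
    (hirr : ∀ x : E, x * x - g.trace * x + g.det ≠ 0) (lam : K)
    (hlam : lam ^ 2 - algebraMap E K g.trace * lam + algebraMap E K g.det = 0)
    (hcoordlam : ∀ z : K, ∃ p q : E, z = algebraMap E K p + algebraMap E K q * lam)
    (J : Matrix (Fin 3) (Fin 3) E) (hτJ : ((φ (g, u)).map σ)ᵀ * J * φ (g, u) = J)
    (hx₀ : ((u, lam) : E × K) * (σ u, σK lam) = 1) :
    ∃ φ' : (E × K) →ₐ[E] Matrix (Fin 3) (Fin 3) E, Function.Injective φ' ∧ φ' ((u, lam) : E × K) = φ (g, u) ∧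
      IsUnit (Matrix.of fun i j : Fin 3 => (((φ (g, u)) ^ (j : ℕ)) *ᵥ
        ((c : Matrix (Fin 3) (Fin 3) E) *ᵥ (Pi.single (endoPerm (Sum.inl 0)) (1 : E) + Pi.single (endoPerm (Sum.inr 0)) (1 : E)))) i).det ∧
      (∀ b : E × K, ∃ P : E[X], aeval ((u, lam) : E × K) P = b) ∧
      (∀ b : E × K, J * φ' (RingHom.prodMap σ σK b) = ((φ' b).map σ)ᵀ * J) := by
  obtain ⟨φ', hφ'inj, hφ'x, hK, hall⟩ := exists_endoscopicFrame_of_blockFrame c φ hφ g u h10 hirr lam hlam hcoordlam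
  have hdetg : g.det ≠ 0 := by
    have h := hirr 0
    rwa [zero_mul, mul_zero, zero_sub, neg_zero, zero_add] at h
  have hτu : IsUnit (φ (g, u)).det := by
    rw [det_blockFrame c φ hφ]
    exact (mul_ne_zero hdetg hu).isUnit
  refine ⟨φ', hφ'inj, hφ'x, hK, hall, fun b => ?_⟩
  exact Literature.NumberTheory.Automorphic.hstar_of_algHom_prod u lam σ σK hσK (φ (g, u)) J hτJ hτu hx₀ hall φ' hφ'x b

end Literature.NumberTheory.Rogawski1990

end
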